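import Mathlib
import Summits.ResolutionOfSingularities.ResolutionOfSingularities.Theses.WeightedInvariant
import Literature.AlgebraicGeometry.Resolution.CobordantGame
import Literature.AlgebraicGeometry.Resolution.CobordantChartCoefficients
import Literature.AlgebraicGeometry.Resolution.AxisPolyhedron
import Summits.ResolutionOfSingularities.ResolutionOfSingularities.Theorems.WeightedInvariantLocalWeightedDropTameLift

/-!
# Skeleton v18 — crux `LocalWeightedDrop` (stmt-ResolutionOfSingularities-8899), line `hasse-ridge-face-selection`,
# fifth lead (c3): the APEX-DIMENSION-ONE cut on top of the tame-multiplicity lift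

v17: crux ⟺ CORE W ∧ CORE T (all glue landed, `WeightedInvariantLocalWeightedDropTameLift.lean` p131880).  This reshape carves out of
BOTH cores the germs whose tangent cone has a ONE-dimensional apex (directrix a line), in every characteristic and every dimension:
after a linear change the cone is `F(x')` with trivial apex inside `z = 0` (`stub_axisNormalize`); Hironaka's polyhedron `Δ(g; x'; z)`
lives in `ℝ¹`, its vertex `δ` is dissolved finitely often or the dissolutions converge `z`-adically (`stub_axisPreparation`:
`g ∈ (x')^d` — equimultiple axis — or `δ < ∞` with no non-zero solving vector); then
* `g ∈ (x')^d` ⇒ blow up the axis (weights `(1,…,1,0)`): every exceptional point `c' ≠ 0` is off the apex, order drops, tame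
  (`stub_axisMove`);
* `δ < ∞` prepared ⇒ the weighted move `(m,…,m,1)`, `m = ⌊δ⌋` if `p ∤ ⌊δ⌋` else `⌊δ⌋ - 1`: points with `c_z = 0` are tame (`p ∤ m`)
  with order `< d`; points with `c_z ≠ 0` are tame (weight `1`) and their slice `S` has order `< d` (non-solvability excludes
  `In_δ g(X', c_z) = F(X' - c')` at `c' ≠ 0`; at `c' = 0`, `δ(S) = δ - m < 1`), except when `m = ⌊δ⌋ - 1` at `c' = 0`: then
  `ord S = d`, `δ(S) = δ - m ∈ [1,2)`, and ONE point blow-up of `S` drops the order everywhere — `δ(S) ∉ ℕ`: `in_d S = F`, axis point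
  slice drops since `δ(S) < 2` (`stub_axisPointMove`), elsewhere `apexFreeOrderDrop`; `δ(S) = 1` (`δ ∈ ℕ`, `p ∣ δ`): the cone
  `F + G` of `S` has trivial apex (a non-zero apex vector would solve the vertex: shear argument), so `apexFreeStartsWon`
  (`stub_axisWeightedMove`).
Residual cores: CORE W″ `stub_wildWideApexStartsWon` and CORE T″ `stub_tameWideApexHigherStartsWon` — as W/T but with TWO linearly
independent translation-invariance vectors of the tangent cone when `ord f ≥ 3` (apex of dimension ≥ 2; for N = 3 and `d ≥ 3` this is
the unary cone `ℓ^d`: with `p ∣ d` exactly the purely inseparable / kangaroo core).  Vocabulary: `Literature/…/AxisPolyhedron.lean` (p132370).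
Composition `LocalWeightedDrop_of` sorry-free modulo the seven stubs.
-/

set_option linter.dupNamespace false -- mandated namespace of this single-conjunct summit

namespace Summit.ResolutionOfSingularities.ResolutionOfSingularities.Theorems

open Literature.AlgebraicGeometry.Resolution

/-! ## The seven stubs of v18 -/

/-- B1 — PREPARATION ALONG THE AXIS (Hironaka's vertex dissolution with one free variable; every field).  For `g` of order `d`
whose degree-`d` part involves no `z` and has trivial apex inside `z = 0`, some shear `x' ↦ x' - ψ(z)` (`ψ` a vector of series
in `z` alone without constant and linear terms; legal, linear part the identity) makes `g` EITHER equimultiple along the axis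
(`InAxisIdeal`: no monomial of `x'`-degree `< d`) OR prepared (`δ < ∞` and no non-zero vector solves the vertex at any integer
level).  Proof sketch: while `δ(g) = M ∈ ℕ` and `Solvable d M lam g` with `lam ≠ 0`, shear by `lam z^M` (this kills the level-`M`
line and raises `δ`; coefficient formula of a `z`-only shear = finite binomial sums); the `M`'s strictly increase, so either the
process stops (prepared: at the level `δ` by the stopping rule, below `δ` by the trivial apex — `Solvable` there forces
`F(X' + lam) = F(X')` coefficientwise —, above `δ` because `AboveLevel` fails) or `ψ := Σ lam_j z^{M_j}` converges `z`-adically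
and `g∘shear_ψ ∈ (x')^d` (the coefficient `(a,c)`, `|a| < d`, agrees with that of the `j`-th stage once `M_j > c`, which vanishes).
The degree-`d` part, the order, `AxisCone` and `TrivialApexX` are unchanged by such shears. -/
theorem stub_axisPreparation : ∀ (k : Type) [Field k] (n d : ℕ) (g : MvPowerSeries (Fin (n + 1)) k),
    g.order = d → AxisPolyhedron.AxisCone d g → AxisPolyhedron.TrivialApexX d g →
    ∃ ψ : Fin n → MvPowerSeries (Fin (n + 1)) k,
      (∀ j, AxisPolyhedron.IsZOnly (ψ j) ∧ MvPowerSeries.constantCoeff (ψ j) = 0 ∧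
        MvPowerSeries.coeff (Finsupp.single (Fin.last n) 1) (ψ j) = 0) ∧
      (∀ i, MvPowerSeries.constantCoeff (AxisPolyhedron.shearFam ψ i) = 0) ∧
      IsUnit (Matrix.det (Matrix.of fun i j =>
        MvPowerSeries.coeff (Finsupp.single j 1) (AxisPolyhedron.shearFam ψ i))) ∧
      (MvPowerSeries.subst (AxisPolyhedron.shearFam ψ) g).order = d ∧
      AxisPolyhedron.AxisCone d (MvPowerSeries.subst (AxisPolyhedron.shearFam ψ) g) ∧
      AxisPolyhedron.TrivialApexX d (MvPowerSeries.subst (AxisPolyhedron.shearFam ψ) g) ∧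
      (AxisPolyhedron.InAxisIdeal d (MvPowerSeries.subst (AxisPolyhedron.shearFam ψ) g) ∨
        (¬ AxisPolyhedron.InAxisIdeal d (MvPowerSeries.subst (AxisPolyhedron.shearFam ψ) g) ∧
          AxisPolyhedron.PreparedAxis d (MvPowerSeries.subst (AxisPolyhedron.shearFam ψ) g))) := by
  sorry

/-- B2 — THE WEIGHTED MOVE FROM A PREPARED AXIS GERM (finite `δ`; characteristic `p`, `k` algebraically closed).  Given the point
move (B3) for the same `(p, k, n, d)` and the singular germs of smaller order, a singular `g` of order `d` with `AxisCone`,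
`TrivialApexX`, `¬ InAxisIdeal` and `PreparedAxis` is won.  Proof sketch: `δ := min c/(d-|a|)` over the monomials with `|a| < d`
(finite, `> 1`), `m := ⌊δ⌋` if `p ∤ ⌊δ⌋` else `⌊δ⌋ - 1` (`≥ 1`, `p ∤ m`, `m ≤ δ`); move `(X, (m,…,m,1))`; the `s`-exponent is `m·d`;
at `c_z = 0`, `c' ≠ 0`: `g♯|_{s = y_z = 0} = F(c' + y')` has order `< d` (trivial apex), tame at a weight-`m` slot (`p ∤ m`,
`tameSlice`), slice won by hypothesis; at `c_z ≠ 0` (weight `1`, tame) the slice is `S = Σ g_{a,c} s^{m|a|+c-md}(c'+y')^a c_z^c`: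
`c' ≠ 0` ⇒ `S|_{s=0} = In(g)(c' + y', c_z)` has order `< d` unless `In(g)(X', c_z) = F(X' - c')`, which by weighted homogeneity
means `Solvable d δ (-c'/c_z^δ) g` — excluded; `c' = 0` ⇒ `δ(S) = δ - m`: `< 1` (order drops) if `m = ⌊δ⌋`, else `S` has order `d`,
`AxisCone` (when `δ ∉ ℕ`) with `TrivialApexX` and `¬ AboveLevel d 2 1 S`, won by B3, or (`δ ∈ ℕ`) its cone `F + G` has trivial apex
(an apex vector `(u', u_s)`, `u_s ≠ 0`, gives `in_d S = F(y' - s u'/u_s)` by the shear argument, i.e. `Solvable d δ lam g` with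
`lam = -u'/(u_s c_z^δ) ≠ 0`), won by `TangentConeCut.apexFreeStartsWon`; climb back by `won_cyl`/`won_subst_iff`/`won_unit_mul_iff`. -/
theorem stub_axisWeightedMove : ∀ (p : ℕ), p.Prime → ∀ (k : Type) [Field k] [CharP k p] [IsAlgClosed k] (n d : ℕ)
    (g : MvPowerSeries (Fin (n + 1)) k), CobordantGame.IsSingular k g → g.order = d →
    AxisPolyhedron.AxisCone d g → AxisPolyhedron.TrivialApexX d g → ¬ AxisPolyhedron.InAxisIdeal d g →
    AxisPolyhedron.PreparedAxis d g →
    (∀ h : MvPowerSeries (Fin (n + 1)) k, CobordantGame.IsSingular k h → h.order < g.order →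
      CobordantGame.Won k (n + 1) h) →
    (∀ S : MvPowerSeries (Fin (n + 1)) k, CobordantGame.IsSingular k S → S.order = d →
      AxisPolyhedron.AxisCone d S → AxisPolyhedron.TrivialApexX d S → ¬ AxisPolyhedron.AboveLevel d 2 1 S →
      (∀ h : MvPowerSeries (Fin (n + 1)) k, CobordantGame.IsSingular k h → h.order < S.order →
        CobordantGame.Won k (n + 1) h) →
      CobordantGame.Won k (n + 1) S) →
    CobordantGame.Won k (n + 1) g := by
  sorry

/-- B3 — THE POINT MOVE FROM AN AXIS GERM WITH `δ < 2` (characteristic `p`).  A singular `S` of order `d` with `AxisCone`,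
`TrivialApexX` and some monomial `x'^a z^c`, `|a| < d`, `c < 2(d - |a|)` is won given the singular germs of smaller order: blow up
the point `(X, (1,…,1))`; at `c ≠ 0` off the axis the slice has order `< d` (`stub_apexFreeOrderDrop`: slice order `d` forces
translation invariance by `c`, and with `AxisCone` + `TrivialApexX` the invariance vectors are the multiples of `e_z`); at the axis
point `(0, c_z)` the `z`-slot slice is `Σ S_{a,c} s^{|a|+c-d} y'^a c_z^c`, containing a monomial of degree `2|a| + c - d < d`;
every point has weight `1` (tame), so `tameSlice` + the hypothesis + `won_cyl`/`won_subst_iff`/`won_unit_mul_iff` finish. -/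
theorem stub_axisPointMove : ∀ (p : ℕ), p.Prime → ∀ (k : Type) [Field k] [CharP k p] (n d : ℕ)
    (S : MvPowerSeries (Fin (n + 1)) k), CobordantGame.IsSingular k S → S.order = d →
    AxisPolyhedron.AxisCone d S → AxisPolyhedron.TrivialApexX d S → ¬ AxisPolyhedron.AboveLevel d 2 1 S →
    (∀ h : MvPowerSeries (Fin (n + 1)) k, CobordantGame.IsSingular k h → h.order < S.order →
      CobordantGame.Won k (n + 1) h) →
    CobordantGame.Won k (n + 1) S := by
  sorry

/-- B4 — THE AXIS MOVE (equimultiple axis; characteristic `p`).  A singular `g` of order `d` with `g ∈ (x')^d` (`InAxisIdeal`) and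
`TrivialApexX` is won given the singular germs of smaller order: blow up the axis `(X, (1,…,1,0))`; at an exceptional point
(`c' ≠ 0`, `c_z = 0` by convention) `g♯|_{s = 0, y_z = 0} = F(c' + y')` has order `mult_{c'} F < d` (trivial apex; the other
terms carry `s` or `y_z`), the point is tame (weight `1`), slice and conclude as in B3. -/
theorem stub_axisMove : ∀ (p : ℕ), p.Prime → ∀ (k : Type) [Field k] [CharP k p] (n d : ℕ)
    (g : MvPowerSeries (Fin (n + 1)) k), CobordantGame.IsSingular k g → g.order = d →
    AxisPolyhedron.InAxisIdeal d g → AxisPolyhedron.TrivialApexX d g →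
    (∀ h : MvPowerSeries (Fin (n + 1)) k, CobordantGame.IsSingular k h → h.order < g.order →
      CobordantGame.Won k (n + 1) h) →
    CobordantGame.Won k (n + 1) g := by
  sorry

/-- B5 — AXIS NORMALISATION (linear algebra; `k` algebraically closed, hence infinite).  If the tangent cone of `f` (order
`d ≥ 3`, `N = n + 3` variables) has a non-zero translation-invariance vector and all its invariance vectors are collinear, then
after an invertible LINEAR change `θ` (last column the invariance vector) `f∘θ` has order `d`, its degree-`d` part involves no `z`
(`AxisCone`: a polynomial invariant under all translations in `z` has no `z`, `k` infinite; `initEval (f∘θ) v = initEval f (M v)`),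
and trivial apex inside `z = 0` (`TrivialApexX`: an invariance vector `(u', 0)` of `f∘θ` gives the invariance vector `M(u',0)` of
`f`, collinear with `M e_z`, so `u' = 0`). -/
theorem stub_axisNormalize : ∀ (k : Type) [Field k] [IsAlgClosed k] (n : ℕ) (f : MvPowerSeries (Fin (n + 3)) k),
    CobordantGame.IsSingular k f → ∀ (d : ℕ), f.order = d → 2 < d →
    (∃ c : Fin (n + 3) → k, c ≠ 0 ∧ ∀ v : Fin (n + 3) → k,
      CobordantChart.initEval (fun _ : Fin (n + 3) => 1) (v + c) d f =
        CobordantChart.initEval (fun _ : Fin (n + 3) => 1) v d f) →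
    (∀ c₁ c₂ : Fin (n + 3) → k,
      (∀ v : Fin (n + 3) → k, CobordantChart.initEval (fun _ : Fin (n + 3) => 1) (v + c₁) d f =
        CobordantChart.initEval (fun _ : Fin (n + 3) => 1) v d f) →
      (∀ v : Fin (n + 3) → k, CobordantChart.initEval (fun _ : Fin (n + 3) => 1) (v + c₂) d f =
        CobordantChart.initEval (fun _ : Fin (n + 3) => 1) v d f) →
      ∃ α β : k, (α ≠ 0 ∨ β ≠ 0) ∧ α • c₁ + β • c₂ = 0) →
    ∃ θ : Fin (n + 3) → MvPowerSeries (Fin (n + 3)) k, (∀ i, MvPowerSeries.constantCoeff (θ i) = 0) ∧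
      IsUnit (Matrix.det (Matrix.of fun i j => MvPowerSeries.coeff (Finsupp.single j 1) (θ i))) ∧
      (MvPowerSeries.subst θ f).order = d ∧
      AxisPolyhedron.AxisCone d (MvPowerSeries.subst θ f) ∧
      AxisPolyhedron.TrivialApexX d (MvPowerSeries.subst θ f) := by
  sorry

/-- CORE W″ — RESIDUAL WILD CORE WITH WIDE APEX (open mathematics).  As CORE W (`p ∣ ord f`, tangent quadric a square), but for
`ord f ≥ 3` the tangent cone has TWO linearly independent translation-invariance vectors (apex of dimension `≥ 2`; for N = 3: the
unary cones `ℓ^d`, `p ∣ d` — purely inseparable `z^{p^e m} + …`, Hauser's kangaroo / Moh's examples). -/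
theorem stub_wildWideApexStartsWon : ∀ (p : ℕ), p.Prime → ∀ (k : Type) [Field k] [CharP k p] [IsAlgClosed k]
    (n : ℕ), (∀ m : ℕ, m < n + 3 → ∀ g : MvPowerSeries (Fin m) k,
      CobordantGame.IsSingular k g → CobordantGame.Won k m g) →
    ∀ (f : MvPowerSeries (Fin (n + 3)) k), CobordantGame.IsSingular k f →
    (∀ g : MvPowerSeries (Fin (n + 3)) k, CobordantGame.IsSingular k g → g.order < f.order →
      CobordantGame.Won k (n + 3) g) →
    ∀ (d : ℕ), f.order = d → p ∣ d →
    (∃ ℓ : Fin (n + 3) → k, ∀ i j : Fin (n + 3),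
      MvPowerSeries.coeff (Finsupp.single i 1 + Finsupp.single j 1) f =
        MvPowerSeries.coeff (Finsupp.single i 1 + Finsupp.single j 1)
          ((∑ l, MvPowerSeries.C (ℓ l) * MvPowerSeries.X l) ^ 2)) →
    (2 < d → ∃ c₁ c₂ : Fin (n + 3) → k, (∀ α β : k, α • c₁ + β • c₂ = 0 → α = 0 ∧ β = 0) ∧
      (∀ v : Fin (n + 3) → k, CobordantChart.initEval (fun _ : Fin (n + 3) => 1) (v + c₁) d f =
        CobordantChart.initEval (fun _ : Fin (n + 3) => 1) v d f) ∧
      (∀ v : Fin (n + 3) → k, CobordantChart.initEval (fun _ : Fin (n + 3) => 1) (v + c₂) d f =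
        CobordantChart.initEval (fun _ : Fin (n + 3) => 1) v d f)) →
    CobordantGame.Won k (n + 3) f := by
  sorry

/-- CORE T″ — RESIDUAL TAME CORE WITH WIDE APEX IN `≥ 4` VARIABLES (open / printed for N = 4 only).  As CORE T (`p ∤ ord f`,
tangent quadric a square, `N ≥ 4`), but for `ord f ≥ 3` the tangent cone has two linearly independent translation-invariance
vectors. -/
theorem stub_tameWideApexHigherStartsWon : ∀ (p : ℕ), p.Prime → ∀ (k : Type) [Field k] [CharP k p] [IsAlgClosed k]
    (n : ℕ), (∀ m : ℕ, m < n + 4 → ∀ g : MvPowerSeries (Fin m) k,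
      CobordantGame.IsSingular k g → CobordantGame.Won k m g) →
    ∀ (f : MvPowerSeries (Fin (n + 4)) k), CobordantGame.IsSingular k f →
    (∀ g : MvPowerSeries (Fin (n + 4)) k, CobordantGame.IsSingular k g → g.order < f.order →
      CobordantGame.Won k (n + 4) g) →
    ∀ (d : ℕ), f.order = d → ¬ p ∣ d →
    (∃ ℓ : Fin (n + 4) → k, ∀ i j : Fin (n + 4),
      MvPowerSeries.coeff (Finsupp.single i 1 + Finsupp.single j 1) f =
        MvPowerSeries.coeff (Finsupp.single i 1 + Finsupp.single j 1)
          ((∑ l, MvPowerSeries.C (ℓ l) * MvPowerSeries.X l) ^ 2)) →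
    (2 < d → ∃ c₁ c₂ : Fin (n + 4) → k, (∀ α β : k, α • c₁ + β • c₂ = 0 → α = 0 ∧ β = 0) ∧
      (∀ v : Fin (n + 4) → k, CobordantChart.initEval (fun _ : Fin (n + 4) => 1) (v + c₁) d f =
        CobordantChart.initEval (fun _ : Fin (n + 4) => 1) v d f) ∧
      (∀ v : Fin (n + 4) → k, CobordantChart.initEval (fun _ : Fin (n + 4) => 1) (v + c₂) d f =
        CobordantChart.initEval (fun _ : Fin (n + 4) => 1) v d f)) →
    CobordantGame.Won k (n + 4) f := by
  sorry

/-! ## The composition (sorry-free modulo the stubs) -/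

namespace AxisCut

open Literature.AlgebraicGeometry.Resolution.CobordantGame

/-- GERMS WITH A ONE-DIMENSIONAL APEX ARE WON (every characteristic, `N = n + 3`), given the singular germs of smaller order:
normalise (B5), prepare (B1), then the axis move (B4) or the weighted move (B2 fed with B3). -/
theorem axisStartsWon (p : ℕ) (hp : p.Prime) (k : Type) [Field k] [CharP k p] [IsAlgClosed k] (n : ℕ)
    (f : MvPowerSeries (Fin (n + 3)) k) (hf : IsSingular k f)
    (hord : ∀ g : MvPowerSeries (Fin (n + 3)) k, IsSingular k g → g.order < f.order → Won k (n + 3) g)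
    (d : ℕ) (hd : f.order = d) (hd2 : 2 < d)
    (hone : ∃ c : Fin (n + 3) → k, c ≠ 0 ∧ ∀ v : Fin (n + 3) → k,
      CobordantChart.initEval (fun _ : Fin (n + 3) => 1) (v + c) d f =
        CobordantChart.initEval (fun _ : Fin (n + 3) => 1) v d f)
    (hcol : ∀ c₁ c₂ : Fin (n + 3) → k,
      (∀ v : Fin (n + 3) → k, CobordantChart.initEval (fun _ : Fin (n + 3) => 1) (v + c₁) d f =
        CobordantChart.initEval (fun _ : Fin (n + 3) => 1) v d f) →
      (∀ v : Fin (n + 3) → k, CobordantChart.initEval (fun _ : Fin (n + 3) => 1) (v + c₂) d f =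
        CobordantChart.initEval (fun _ : Fin (n + 3) => 1) v d f) →
      ∃ α β : k, (α ≠ 0 ∨ β ≠ 0) ∧ α • c₁ + β • c₂ = 0) :
    Won k (n + 3) f := by
  obtain ⟨θ, hθ0, hθdet, hgd, hcone, hapex⟩ := stub_axisNormalize k n f hf d hd hd2 hone hcol
  have hg : IsSingular k (MvPowerSeries.subst θ f) := TangentConeCut.isSingular_subst hθ0 hθdet hf
  have hordg : ∀ h : MvPowerSeries (Fin (n + 3)) k, IsSingular k h → h.order < (MvPowerSeries.subst θ f).order →
      Won k (n + 3) h := fun h hh hlt => hord h hh (by rw [hd, ← hgd]; exact hlt)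
  obtain ⟨ψ, -, hψ0, hψdet, hg'd, hcone', hapex', hcases⟩ :=
    stub_axisPreparation k (n + 2) d (MvPowerSeries.subst θ f) hgd hcone hapex
  have hg' : IsSingular k (MvPowerSeries.subst (AxisPolyhedron.shearFam ψ) (MvPowerSeries.subst θ f)) :=
    TangentConeCut.isSingular_subst hψ0 hψdet hg
  have hordg' : ∀ h : MvPowerSeries (Fin (n + 3)) k, IsSingular k h →
      h.order < (MvPowerSeries.subst (AxisPolyhedron.shearFam ψ) (MvPowerSeries.subst θ f)).order → Won k (n + 3) h :=
    fun h hh hlt => hord h hh (by rw [hd, ← hg'd]; exact hlt)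
  have hW : Won k (n + 3) (MvPowerSeries.subst (AxisPolyhedron.shearFam ψ) (MvPowerSeries.subst θ f)) := by
    rcases hcases with hin | ⟨hnot, hprep⟩
    · exact stub_axisMove p hp k (n + 2) d _ hg' hg'd hin hapex' hordg'
    · exact stub_axisWeightedMove p hp k (n + 2) d _ hg' hg'd hcone' hapex' hnot hprep hordg'
        (fun S hS hSd hSc hSa hSl hordS => stub_axisPointMove p hp k (n + 2) d S hS hSd hSc hSa hSl hordS)
  rw [won_subst_iff hψ0 hψdet, won_subst_iff hθ0 hθdet] at hW
  exact hW

/-- THE TANGENT-CONE SPLIT with LOCAL core obligations, now only for apices of dimension `≥ 2` when `d ≥ 3` (the one-dimensional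
apex is `axisStartsWon`); otherwise as `TameLift.coneStartsWon_local`. -/
theorem coneStartsWon_local (p : ℕ) (hp : p.Prime) (k : Type) [Field k] [CharP k p] [IsAlgClosed k]
    (n : ℕ) (f : MvPowerSeries (Fin (n + 3)) k) (hf : IsSingular k f)
    (hord : ∀ g : MvPowerSeries (Fin (n + 3)) k, IsSingular k g → g.order < f.order → Won k (n + 3) g)
    (ℓ : Fin (n + 3) → k) (hℓ : ∀ i j : Fin (n + 3),
      MvPowerSeries.coeff (Finsupp.single i 1 + Finsupp.single j 1) f =
        MvPowerSeries.coeff (Finsupp.single i 1 + Finsupp.single j 1)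
          ((∑ l, MvPowerSeries.C (ℓ l) * MvPowerSeries.X l) ^ 2))
    (d : ℕ) (hd : f.order = d)
    (hW : p ∣ d → (2 < d → ∃ c₁ c₂ : Fin (n + 3) → k, (∀ α β : k, α • c₁ + β • c₂ = 0 → α = 0 ∧ β = 0) ∧
      (∀ v : Fin (n + 3) → k, CobordantChart.initEval (fun _ : Fin (n + 3) => 1) (v + c₁) d f =
        CobordantChart.initEval (fun _ : Fin (n + 3) => 1) v d f) ∧
      (∀ v : Fin (n + 3) → k, CobordantChart.initEval (fun _ : Fin (n + 3) => 1) (v + c₂) d f =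
        CobordantChart.initEval (fun _ : Fin (n + 3) => 1) v d f)) → Won k (n + 3) f)
    (hT : 0 < n → ¬ p ∣ d → (2 < d → ∃ c₁ c₂ : Fin (n + 3) → k, (∀ α β : k, α • c₁ + β • c₂ = 0 → α = 0 ∧ β = 0) ∧
      (∀ v : Fin (n + 3) → k, CobordantChart.initEval (fun _ : Fin (n + 3) => 1) (v + c₁) d f =
        CobordantChart.initEval (fun _ : Fin (n + 3) => 1) v d f) ∧
      (∀ v : Fin (n + 3) → k, CobordantChart.initEval (fun _ : Fin (n + 3) => 1) (v + c₂) d f =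
        CobordantChart.initEval (fun _ : Fin (n + 3) => 1) v d f)) → Won k (n + 3) f) :
    Won k (n + 3) f := by
  have hd2 : 2 ≤ d := by
    have h := (FormalCoordChange.two_le_order_iff f).mpr hf.2
    rw [hd] at h
    exact_mod_cast h
  by_cases hℓ0 : ∃ i, ℓ i ≠ 0
  · -- DOUBLE POINT with square tangent quadric `ℓ² ≠ 0`: `d = 2`
    obtain ⟨i, hi⟩ := hℓ0
    have hd' : d = 2 := TameLift.order_eq_two_of_sq hf hℓ hi hd
    by_cases hp2 : p = 2
    · subst hp2
      exact hW (by rw [hd']) (fun h => absurd h (by omega))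
    · cases n with
      | zero =>
        exact TangentConeCut.tameDoublePointSurfaceWon (fun k _ _ => planeGermNonNCCount k) p hp hp2 k f hf
          ⟨ℓ, ⟨i, hi⟩, hℓ⟩
      | succ n =>
        exact hT (Nat.succ_pos n) (fun h => hp2 ((Nat.prime_dvd_prime_iff_eq hp Nat.prime_two).mp (hd' ▸ h)))
          (fun h => absurd h (by omega))
  · -- tangent quadric ZERO: read the tangent cone of degree `d`
    by_cases hapex : ∃ c : Fin (n + 3) → k, c ≠ 0 ∧ ∀ v : Fin (n + 3) → k,
        CobordantChart.initEval (fun _ : Fin (n + 3) => 1) (v + c) d f =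
          CobordantChart.initEval (fun _ : Fin (n + 3) => 1) v d f
    swap
    · push Not at hapex
      exact TangentConeCut.apexFreeStartsWon p hp k (Nat.succ_pos _) f d hd hord hapex
    -- apex of dimension exactly one (and `d ≥ 3`): the axis cut
    by_cases hwide : ∃ c₁ c₂ : Fin (n + 3) → k, (∀ α β : k, α • c₁ + β • c₂ = 0 → α = 0 ∧ β = 0) ∧
        (∀ v : Fin (n + 3) → k, CobordantChart.initEval (fun _ : Fin (n + 3) => 1) (v + c₁) d f =
          CobordantChart.initEval (fun _ : Fin (n + 3) => 1) v d f) ∧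
        (∀ v : Fin (n + 3) → k, CobordantChart.initEval (fun _ : Fin (n + 3) => 1) (v + c₂) d f =
          CobordantChart.initEval (fun _ : Fin (n + 3) => 1) v d f)
    swap
    · by_cases hd3 : 2 < d
      · refine axisStartsWon p hp k n f hf hord d hd hd3 hapex fun c₁ c₂ h₁ h₂ => ?_
        by_contra hdep
        push Not at hdep
        refine hwide ⟨c₁, c₂, fun α β hαβ => ?_, h₁, h₂⟩
        by_contra hne
        rcases not_and_or.mp hne with hα | hβ
        · exact hdep α β (Or.inl hα) hαβ
        · exact hdep α β (Or.inr hβ) hαβ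
      · -- `d = 2` with zero quadratic part cannot occur, but the cores absorb it vacuously
        by_cases hpd : p ∣ d
        · exact hW hpd (fun h => absurd h hd3)
        · cases n with
          | zero =>
            obtain ⟨e, rfl⟩ : ∃ e, d = e + 2 := ⟨d - 2, by omega⟩
            exact TameLift.tameSurfaceWon p hp k e f hf hd hpd hord
          | succ n => exact hT (Nat.succ_pos n) hpd (fun h => absurd h hd3)
    by_cases hpd : p ∣ d
    · exact hW hpd (fun _ => hwide)
    · cases n with
      | zero =>
        obtain ⟨e, rfl⟩ : ∃ e, d = e + 2 := ⟨d - 2, by omega⟩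
        exact TameLift.tameSurfaceWon p hp k e f hf hd hpd hord
      | succ n => exact hT (Nat.succ_pos n) hpd (fun _ => hwide)

section Cores

variable (hW : ∀ (p : ℕ), p.Prime → ∀ (k : Type) [Field k] [CharP k p] [IsAlgClosed k]
    (n : ℕ), (∀ m : ℕ, m < n + 3 → ∀ g : MvPowerSeries (Fin m) k,
      CobordantGame.IsSingular k g → CobordantGame.Won k m g) →
    ∀ (f : MvPowerSeries (Fin (n + 3)) k), CobordantGame.IsSingular k f →
    (∀ g : MvPowerSeries (Fin (n + 3)) k, CobordantGame.IsSingular k g → g.order < f.order →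
      CobordantGame.Won k (n + 3) g) →
    ∀ (d : ℕ), f.order = d → p ∣ d →
    (∃ ℓ : Fin (n + 3) → k, ∀ i j : Fin (n + 3),
      MvPowerSeries.coeff (Finsupp.single i 1 + Finsupp.single j 1) f =
        MvPowerSeries.coeff (Finsupp.single i 1 + Finsupp.single j 1)
          ((∑ l, MvPowerSeries.C (ℓ l) * MvPowerSeries.X l) ^ 2)) →
    (2 < d → ∃ c₁ c₂ : Fin (n + 3) → k, (∀ α β : k, α • c₁ + β • c₂ = 0 → α = 0 ∧ β = 0) ∧
      (∀ v : Fin (n + 3) → k, CobordantChart.initEval (fun _ : Fin (n + 3) => 1) (v + c₁) d f =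
        CobordantChart.initEval (fun _ : Fin (n + 3) => 1) v d f) ∧
      (∀ v : Fin (n + 3) → k, CobordantChart.initEval (fun _ : Fin (n + 3) => 1) (v + c₂) d f =
        CobordantChart.initEval (fun _ : Fin (n + 3) => 1) v d f)) →
    CobordantGame.Won k (n + 3) f)
variable (hT : ∀ (p : ℕ), p.Prime → ∀ (k : Type) [Field k] [CharP k p] [IsAlgClosed k]
    (n : ℕ), (∀ m : ℕ, m < n + 4 → ∀ g : MvPowerSeries (Fin m) k,
      CobordantGame.IsSingular k g → CobordantGame.Won k m g) →
    ∀ (f : MvPowerSeries (Fin (n + 4)) k), CobordantGame.IsSingular k f →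
    (∀ g : MvPowerSeries (Fin (n + 4)) k, CobordantGame.IsSingular k g → g.order < f.order →
      CobordantGame.Won k (n + 4) g) →
    ∀ (d : ℕ), f.order = d → ¬ p ∣ d →
    (∃ ℓ : Fin (n + 4) → k, ∀ i j : Fin (n + 4),
      MvPowerSeries.coeff (Finsupp.single i 1 + Finsupp.single j 1) f =
        MvPowerSeries.coeff (Finsupp.single i 1 + Finsupp.single j 1)
          ((∑ l, MvPowerSeries.C (ℓ l) * MvPowerSeries.X l) ^ 2)) →
    (2 < d → ∃ c₁ c₂ : Fin (n + 4) → k, (∀ α β : k, α • c₁ + β • c₂ = 0 → α = 0 ∧ β = 0) ∧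
      (∀ v : Fin (n + 4) → k, CobordantChart.initEval (fun _ : Fin (n + 4) => 1) (v + c₁) d f =
        CobordantChart.initEval (fun _ : Fin (n + 4) => 1) v d f) ∧
      (∀ v : Fin (n + 4) → k, CobordantChart.initEval (fun _ : Fin (n + 4) => 1) (v + c₂) d f =
        CobordantChart.initEval (fun _ : Fin (n + 4) => 1) v d f)) →
    CobordantGame.Won k (n + 4) f)

include hW hT in
/-- ALL SINGULAR GERMS IN DIMENSION `n + 3` ARE WON given the lower dimensions, modulo CORE W″ / CORE T″. -/
theorem fixedDimStartsWon (p : ℕ) (hp : p.Prime) (k : Type) [Field k] [CharP k p] [IsAlgClosed k]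
    (n : ℕ) (IH : ∀ m : ℕ, m < n + 3 → ∀ g : MvPowerSeries (Fin m) k, IsSingular k g → Won k m g) :
    ∀ (f : MvPowerSeries (Fin (n + 3)) k), IsSingular k f → Won k (n + 3) f := by
  suffices key : ∀ (d : ℕ) (f : MvPowerSeries (Fin (n + 3)) k), f.order = d → IsSingular k f → Won k (n + 3) f by
    intro f hf
    exact key _ f ((MvPowerSeries.ne_zero_iff_order_finite).mp hf.1).symm hf
  intro d
  induction d using Nat.strong_induction_on with
  | _ d IHd =>
    intro f hfd hf
    have hord : ∀ g : MvPowerSeries (Fin (n + 3)) k, IsSingular k g → g.order < f.order → Won k (n + 3) g := by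
      intro g hg hlt
      have hgo : (g.order.toNat : ℕ∞) = g.order := (MvPowerSeries.ne_zero_iff_order_finite).mp hg.1
      refine IHd g.order.toNat ?_ g hgo.symm hg
      have : (g.order.toNat : ℕ∞) < (d : ℕ∞) := by rw [hgo, ← hfd]; exact hlt
      exact_mod_cast this
    rcases stub_coneDichotomy k (n + 1) f hf with hhyp | ⟨ℓ, hℓ⟩
    · exact TangentConeCut.hyperbolicStartsWon (fun g hg => IH (n + 1) (by omega) g hg) f hf hhyp
    · refine coneStartsWon_local p hp k n f hf hord ℓ hℓ d hfd
        (fun hpd hcyl => hW p hp k n IH f hf hord d hfd hpd ⟨ℓ, hℓ⟩ hcyl) (fun hn hpd hcyl => ?_)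
      cases n with
      | zero => exact absurd hn (lt_irrefl 0)
      | succ n => exact hT p hp k n IH f hf hord d hfd hpd ⟨ℓ, hℓ⟩ hcyl

include hW hT in
/-- EVERY SINGULAR GERM IS WON modulo CORE W″ / CORE T″: strong induction on `N`; `N ≤ 2` landed (`PlaneWon`). -/
theorem higherStartsWon (p : ℕ) (hp : p.Prime) (k : Type) [Field k] [CharP k p] [IsAlgClosed k] :
    ∀ (N : ℕ) (f : MvPowerSeries (Fin N) k), IsSingular k f → Won k N f := by
  intro N
  induction N using Nat.strong_induction_on with
  | _ N IH =>
    intro f hf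
    match N, f, hf, IH with
    | 0, f, hf, _ => exact absurd hf (PlaneWon.not_isSingular_fin_zero f)
    | 1, f, hf, _ => exact PlaneWon.lineWon f hf
    | 2, f, hf, _ => exact stub_planeWon k f hf
    | n + 3, f, hf, IH => exact fixedDimStartsWon hW hT p hp k n (fun m hm g hg => IH m hm g hg) f hf

end Cores

end AxisCut

/-- THE CRUX modulo the seven stubs of v18 (B1–B5 of the axis cut and the two wide-apex cores): by the inductive normal form
`localWeightedDrop_iff_allWon`. -/
theorem LocalWeightedDrop_of :
    Summit.ResolutionOfSingularities.ResolutionOfSingularities.Theses.WeightedInvariant.LocalWeightedDrop := by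
  rw [localWeightedDrop_iff_allWon]
  intro p hp k _ _ _ n f hf
  exact AxisCut.higherStartsWon stub_wildWideApexStartsWon stub_tameWideApexHigherStartsWon p hp k n f hf

end Summit.ResolutionOfSingularities.ResolutionOfSingularities.Theorems
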